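import Literature.Geometry.Kaehler.AmbientHolomorphicAtlas
import HarnessLib

/-!
# Re-charting a complex manifold by holomorphic charts: the ambient-holomorphic atlas of `univ`

Layer `Literature/Geometry/Kaehler`, companion of `AmbientHolomorphicAtlas` (the complex manifold
`𝒜.Carrier` attached to an atlas of ambient-holomorphic charts of a subset `Z ⊆ M`; P. Griffiths,
J. Harris, *Principles of Algebraic Geometry* (1978), Ch. 0 §2). The case `Z = univ`: ANY family of
local biholomorphisms `e_x : M ⇀ ℂᵈ` (`x ∈ (e_x).source`, `e_x` holomorphic on its source, `e_x⁻¹`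
holomorphic on its target — e.g. straightening charts of the holomorphic implicit function theorem,
`exists_holStraightening`) is an atlas of the SAME complex manifold, presented on the type synonym
`𝒜.Carrier` with `chartAt y = e_{val y} ∘ val`:

* `AmbientHolChart.ofUniv e he hes` — a local biholomorphism of `M` as an ambient-holomorphic chart of
  `univ ⊆ M`; `AmbientHolAtlas.ofUniv` — the atlas of a family of them;
* `AmbientHolAtlas.ofPoint : M → 𝒜.Carrier` — the inverse of the inclusion `val` (for `Z = univ`),
  `valHomeomorph : 𝒜.Carrier ≃ₜ M`; **both `val` and `ofPoint` are holomorphic**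
  (`mdifferentiable_val`, `mdifferentiable_ofPoint`), so that **holomorphy of functions and maps is the
  same for the two atlases** (`mdifferentiableOn_comp_val_iff`, `mdifferentiableAt_comp_val_iff`,
  `mdifferentiableWithinAt_comp_val_iff`);
* `AmbientHolAtlas.extChartAt_ofUniv_apply` / `extChartAt_ofUniv_source` — the extended charts of
  the re-charted manifold ARE the prescribed `e_x` (read through `val`).

This is the device by which the nested Leray data of the Cartan–Serre finiteness theorem
(`DolbeaultLerayDatum`, members convex IN THE CHARTS OF THE ATLAS) are taken subordinate to
straightening charts of a transverse flag of hyperplane sections (Serre's dimension count in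
dimension `n`, `Literature.AlgebraicGeometry.HodgeTheory.kodairaSerre_exists_globalSection_algebraicTwist`).
Everything is proved; the definitions are `ofUniv` (twice), `ofPoint`, `valHomeomorph`.

## References

* P. Griffiths, J. Harris, *Principles of Algebraic Geometry*, Wiley (1978), Ch. 0 §2 pp. 18–20.
  [GriffithsHarris1978]
-/

noncomputable section

open scoped Manifold ContDiff Topology
open Set Filter Function

namespace Literature.Geometry.Kaehler

variable {E : Type*} [NormedAddCommGroup E] [NormedSpace ℂ E]
  {M : Type*} [TopologicalSpace M] [ChartedSpace E M]
  {F : Type*} [NormedAddCommGroup F] [NormedSpace ℂ F]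
  {F' : Type*} [NormedAddCommGroup F'] [NormedSpace ℂ F'] {d : ℕ}

/-! ### A local biholomorphism of `M` as an ambient-holomorphic chart of `univ` -/

namespace AmbientHolChart

/-- **A local biholomorphism `e : M ⇀ F` as an ambient-holomorphic chart of `univ ⊆ M`** (the chart
`e ∘ val` on `↥univ`; it extends holomorphically by `e` itself, and `val ∘ (e ∘ val)⁻¹ = e⁻¹`).
[cite: GriffithsHarris1978, Ch. 0 §2 pp. 18–20] -/
def ofUniv (e : OpenPartialHomeomorph M F) (he : MDifferentiableOn 𝓘(ℂ, E) 𝓘(ℂ, F) e e.source)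
    (hes : MDifferentiableOn 𝓘(ℂ, F) 𝓘(ℂ, E) e.symm e.target) : AmbientHolChart E (univ : Set M) F where
  toOpenPartialHomeomorph := (Homeomorph.Set.univ M).toOpenPartialHomeomorph.trans e
  exists_extend' z hz := by
    refine ⟨e.source, e.open_source, ?_, e, he, fun y _ _ ↦ rfl⟩
    rw [OpenPartialHomeomorph.trans_source] at hz
    exact hz.2
  mdifferentiableOn_val_symm' := by
    have ht : ((Homeomorph.Set.univ M).toOpenPartialHomeomorph.trans e).target = e.target := by
      rw [OpenPartialHomeomorph.trans_target, Homeomorph.toOpenPartialHomeomorph_target, preimage_univ,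
        inter_univ]
    rw [ht]
    exact hes

/-- The chart `ofUniv e` is `e ∘ val`. [folklore] -/
@[simp]
theorem ofUniv_apply (e : OpenPartialHomeomorph M F) (he : MDifferentiableOn 𝓘(ℂ, E) 𝓘(ℂ, F) e e.source)
    (hes : MDifferentiableOn 𝓘(ℂ, F) 𝓘(ℂ, E) e.symm e.target) (z : (univ : Set M)) :
    (ofUniv e he hes).toOpenPartialHomeomorph z = e z :=
  rfl

/-- The source of `ofUniv e` is `val⁻¹(e.source)`. [folklore] -/
theorem ofUniv_source (e : OpenPartialHomeomorph M F) (he : MDifferentiableOn 𝓘(ℂ, E) 𝓘(ℂ, F) e e.source)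
    (hes : MDifferentiableOn 𝓘(ℂ, F) 𝓘(ℂ, E) e.symm e.target) :
    (ofUniv e he hes).source = Subtype.val ⁻¹' e.source := by
  change ((Homeomorph.Set.univ M).toOpenPartialHomeomorph.trans e).source = _
  rw [OpenPartialHomeomorph.trans_source, Homeomorph.toOpenPartialHomeomorph_source, univ_inter]
  rfl

/-- The target of `ofUniv e` is `e.target`. [folklore] -/
theorem ofUniv_target (e : OpenPartialHomeomorph M F) (he : MDifferentiableOn 𝓘(ℂ, E) 𝓘(ℂ, F) e e.source)
    (hes : MDifferentiableOn 𝓘(ℂ, F) 𝓘(ℂ, E) e.symm e.target) :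
    (ofUniv e he hes).target = e.target := by
  change ((Homeomorph.Set.univ M).toOpenPartialHomeomorph.trans e).target = _
  rw [OpenPartialHomeomorph.trans_target, Homeomorph.toOpenPartialHomeomorph_target, preimage_univ,
    inter_univ]

/-- The inverse of `ofUniv e` followed by `val` is `e⁻¹`. [folklore] -/
@[simp]
theorem coe_ofUniv_symm_apply (e : OpenPartialHomeomorph M F) (he : MDifferentiableOn 𝓘(ℂ, E) 𝓘(ℂ, F) e e.source)
    (hes : MDifferentiableOn 𝓘(ℂ, F) 𝓘(ℂ, E) e.symm e.target) (w : F) :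
    (((ofUniv e he hes).toOpenPartialHomeomorph.symm w : (univ : Set M)) : M) = e.symm w :=
  rfl

end AmbientHolChart

namespace AmbientHolAtlas

/-! ### The atlas of a family of local biholomorphisms -/

/-- **The ambient-holomorphic atlas of `univ ⊆ M` given by local biholomorphisms `e_x : M ⇀ ℂᵈ`
around every point** (`x ∈ (e_x).source`, `e_x` and `e_x⁻¹` holomorphic).
[cite: GriffithsHarris1978, Ch. 0 §2 pp. 18–20] -/
def ofUniv (e : M → OpenPartialHomeomorph M (Fin d → ℂ)) (hmem : ∀ x, x ∈ (e x).source)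
    (he : ∀ x, MDifferentiableOn 𝓘(ℂ, E) 𝓘(ℂ, Fin d → ℂ) (e x) (e x).source)
    (hes : ∀ x, MDifferentiableOn 𝓘(ℂ, Fin d → ℂ) 𝓘(ℂ, E) (e x).symm (e x).target) :
    AmbientHolAtlas E (univ : Set M) d where
  chart z := AmbientHolChart.ofUniv (e z) (he z) (hes z)
  mem_source z := by
    rw [AmbientHolChart.ofUniv_source]
    exact hmem z

/-! ### `val` is a biholomorphism for `Z = univ` -/

section Univ

variable (𝒜 : AmbientHolAtlas E (univ : Set M) d)

/-- **The inverse `M → 𝒜.Carrier` of the inclusion**, for an atlas of `univ`. [folklore] -/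
def ofPoint (x : M) : 𝒜.Carrier :=
  𝒜.ofSubtype ⟨x, mem_univ x⟩

/-- `val ∘ ofPoint = id`. [folklore] -/
@[simp]
theorem val_ofPoint (x : M) : 𝒜.val (𝒜.ofPoint x) = x :=
  rfl

/-- `ofPoint ∘ val = id`. [folklore] -/
@[simp]
theorem ofPoint_val (y : 𝒜.Carrier) : 𝒜.ofPoint (𝒜.val y) = y :=
  rfl

/-- `val` is surjective for an atlas of `univ`. [folklore] -/
theorem val_surjective : Surjective 𝒜.val := fun x ↦ ⟨𝒜.ofPoint x, rfl⟩

/-- `val` is bijective for an atlas of `univ`. [folklore] -/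
theorem val_bijective : Bijective 𝒜.val :=
  ⟨𝒜.val_injective, 𝒜.val_surjective⟩

/-- `ofPoint` is continuous. [folklore] -/
theorem continuous_ofPoint : Continuous 𝒜.ofPoint :=
  𝒜.continuous_ofSubtype.comp (continuous_id.subtype_mk _)

/-- **`val : 𝒜.Carrier ≃ₜ M`** for an atlas of `univ`. [folklore] -/
def valHomeomorph : 𝒜.Carrier ≃ₜ M where
  toFun := 𝒜.val
  invFun := 𝒜.ofPoint
  left_inv := 𝒜.ofPoint_val
  right_inv := 𝒜.val_ofPoint
  continuous_toFun := 𝒜.continuous_val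
  continuous_invFun := 𝒜.continuous_ofPoint

/-- The homeomorphism is `val`. [folklore] -/
@[simp]
theorem coe_valHomeomorph : (𝒜.valHomeomorph : 𝒜.Carrier → M) = 𝒜.val :=
  rfl

/-- Its inverse is `ofPoint`. [folklore] -/
@[simp]
theorem coe_valHomeomorph_symm : (𝒜.valHomeomorph.symm : M → 𝒜.Carrier) = 𝒜.ofPoint :=
  rfl

/-- `val` is a homeomorphism. [folklore] -/
theorem isHomeomorph_val : IsHomeomorph 𝒜.val :=
  𝒜.valHomeomorph.isHomeomorph

/-- Preimages under `ofPoint` are images under `val`, as preimages: `ofPoint⁻¹(S) = val '' S` read as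
`{x | ofPoint x ∈ S}`; in particular `val⁻¹(ofPoint⁻¹ S) = S`. [folklore] -/
@[simp]
theorem preimage_val_preimage_ofPoint (S : Set 𝒜.Carrier) : 𝒜.val ⁻¹' (𝒜.ofPoint ⁻¹' S) = S := by
  ext y
  simp

/-- `ofPoint⁻¹(val⁻¹ W) = W`. [folklore] -/
@[simp]
theorem preimage_ofPoint_preimage_val (W : Set M) : 𝒜.ofPoint ⁻¹' (𝒜.val ⁻¹' W) = W := by
  ext x
  simp

/-- A compact `M` re-charted is compact. [folklore] -/
instance instCompactSpaceUniv [CompactSpace M] : CompactSpace 𝒜.Carrier :=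
  𝒜.compactSpace isClosed_univ

/-- **`ofPoint : M → 𝒜.Carrier` is holomorphic** (a map into `Z` whose composite with `val` is the
identity). [cite: GriffithsHarris1978, Ch. 0 §2 pp. 18–20] -/
theorem mdifferentiable_ofPoint : MDifferentiable 𝓘(ℂ, E) 𝓘(ℂ, Fin d → ℂ) 𝒜.ofPoint := fun _ ↦
  𝒜.mdifferentiableAt_of_val_comp (g := 𝒜.ofPoint) mdifferentiableAt_id

/-- **Holomorphy within a set at a point is the same for the two atlases**: `u ∘ val` is
holomorphic within `val⁻¹ W` at `y` iff `u` is holomorphic within `W` at `val y`.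
[cite: GriffithsHarris1978, Ch. 0 §2 pp. 18–20] -/
theorem mdifferentiableWithinAt_comp_val_iff {u : M → F} {W : Set M} {y : 𝒜.Carrier} :
    MDifferentiableWithinAt 𝓘(ℂ, Fin d → ℂ) 𝓘(ℂ, F) (u ∘ 𝒜.val) (𝒜.val ⁻¹' W) y ↔
      MDifferentiableWithinAt 𝓘(ℂ, E) 𝓘(ℂ, F) u W (𝒜.val y) := by
  constructor
  · intro h
    have h2 : MDifferentiableWithinAt 𝓘(ℂ, E) 𝓘(ℂ, F) ((u ∘ 𝒜.val) ∘ 𝒜.ofPoint)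
        (𝒜.ofPoint ⁻¹' (𝒜.val ⁻¹' W)) (𝒜.val y) :=
      h.comp (𝒜.val y) (𝒜.mdifferentiable_ofPoint (𝒜.val y)).mdifferentiableWithinAt (fun x hx ↦ hx)
    rwa [𝒜.preimage_ofPoint_preimage_val] at h2
  · intro h
    exact h.comp y (𝒜.mdifferentiable_val y).mdifferentiableWithinAt (fun x hx ↦ hx)

/-- **Holomorphy at a point is the same for the two atlases.** [cite: GriffithsHarris1978, Ch. 0 §2 pp. 18–20] -/
theorem mdifferentiableAt_comp_val_iff {u : M → F} {y : 𝒜.Carrier} :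
    MDifferentiableAt 𝓘(ℂ, Fin d → ℂ) 𝓘(ℂ, F) (u ∘ 𝒜.val) y ↔
      MDifferentiableAt 𝓘(ℂ, E) 𝓘(ℂ, F) u (𝒜.val y) := by
  rw [← mdifferentiableWithinAt_univ, ← mdifferentiableWithinAt_univ, ← preimage_univ (f := 𝒜.val)]
  exact 𝒜.mdifferentiableWithinAt_comp_val_iff

/-- **Holomorphy on a set is the same for the two atlases**: `u ∘ val` is holomorphic on `val⁻¹ W`
iff `u` is holomorphic on `W`. [cite: GriffithsHarris1978, Ch. 0 §2 pp. 18–20] -/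
theorem mdifferentiableOn_comp_val_iff {u : M → F} {W : Set M} :
    MDifferentiableOn 𝓘(ℂ, Fin d → ℂ) 𝓘(ℂ, F) (u ∘ 𝒜.val) (𝒜.val ⁻¹' W) ↔
      MDifferentiableOn 𝓘(ℂ, E) 𝓘(ℂ, F) u W := by
  constructor
  · intro h x hx
    have h1 := h (𝒜.ofPoint x) (show 𝒜.val (𝒜.ofPoint x) ∈ W from hx)
    rwa [𝒜.mdifferentiableWithinAt_comp_val_iff] at h1
  · intro h y hy
    exact 𝒜.mdifferentiableWithinAt_comp_val_iff.2 (h _ hy)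

/-- A holomorphic map of `M` read on the re-charted manifold is holomorphic. [folklore] -/
theorem mdifferentiable_comp_val {u : M → F} (hu : MDifferentiable 𝓘(ℂ, E) 𝓘(ℂ, F) u) :
    MDifferentiable 𝓘(ℂ, Fin d → ℂ) 𝓘(ℂ, F) (u ∘ 𝒜.val) := fun y ↦
  𝒜.mdifferentiableAt_comp_val_iff.2 (hu (𝒜.val y))

/-- **The differential of `val` is onto** (indeed invertible: `val ∘ ofPoint = id`). [folklore] -/
theorem surjective_mfderiv_val (y : 𝒜.Carrier) :
    Surjective (mfderiv 𝓘(ℂ, Fin d → ℂ) 𝓘(ℂ, E) 𝒜.val y) := by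
  have h : mfderiv 𝓘(ℂ, E) 𝓘(ℂ, E) (𝒜.val ∘ 𝒜.ofPoint) (𝒜.val y) =
      (mfderiv 𝓘(ℂ, Fin d → ℂ) 𝓘(ℂ, E) 𝒜.val (𝒜.ofPoint (𝒜.val y))).comp
        (mfderiv 𝓘(ℂ, E) 𝓘(ℂ, Fin d → ℂ) 𝒜.ofPoint (𝒜.val y)) :=
    mfderiv_comp (𝒜.val y) (𝒜.mdifferentiable_val _) (𝒜.mdifferentiable_ofPoint _)
  rw [𝒜.ofPoint_val] at h
  have hid : mfderiv 𝓘(ℂ, E) 𝓘(ℂ, E) (𝒜.val ∘ 𝒜.ofPoint) (𝒜.val y) = ContinuousLinearMap.id ℂ _ := by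
    have : 𝒜.val ∘ 𝒜.ofPoint = id := rfl
    rw [this]
    exact mfderiv_id
  intro v
  refine ⟨mfderiv 𝓘(ℂ, E) 𝓘(ℂ, Fin d → ℂ) 𝒜.ofPoint (𝒜.val y) v, ?_⟩
  have h2 := ContinuousLinearMap.ext_iff.1 (hid.symm.trans h) v
  exact h2.symm

/-- **Joint surjectivity of differentials transfers to the re-charted manifold**: if the differentials
of `u_0, …, u_{k-1} : M → ℂ` at `val y` are jointly onto `ℂᵏ`, so are those of the `u_i ∘ val` at `y`
(chain rule through the onto differential of `val`). [folklore] -/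
theorem surjective_pi_mfderiv_comp_val {k : ℕ} {u : Fin k → M → ℂ} {y : 𝒜.Carrier}
    (hu : ∀ i, MDifferentiableAt 𝓘(ℂ, E) 𝓘(ℂ, ℂ) (u i) (𝒜.val y))
    (h : Surjective (ContinuousLinearMap.pi fun i ↦ mfderiv 𝓘(ℂ, E) 𝓘(ℂ, ℂ) (u i) (𝒜.val y))) :
    Surjective (ContinuousLinearMap.pi fun i ↦ mfderiv 𝓘(ℂ, Fin d → ℂ) 𝓘(ℂ, ℂ) (u i ∘ 𝒜.val) y) := by
  have hc : ∀ i, mfderiv 𝓘(ℂ, Fin d → ℂ) 𝓘(ℂ, ℂ) (u i ∘ 𝒜.val) y =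
      (mfderiv 𝓘(ℂ, E) 𝓘(ℂ, ℂ) (u i) (𝒜.val y)).comp (mfderiv 𝓘(ℂ, Fin d → ℂ) 𝓘(ℂ, E) 𝒜.val y) :=
    fun i ↦ mfderiv_comp y (hu i) (𝒜.mdifferentiable_val y)
  intro w
  obtain ⟨v, hv⟩ := h w
  obtain ⟨v', hv'⟩ := 𝒜.surjective_mfderiv_val y v
  refine ⟨v', ?_⟩
  funext i
  have hi := congr_fun hv i
  simp only [ContinuousLinearMap.pi_apply] at hi ⊢
  rw [hc i]
  change (mfderiv 𝓘(ℂ, E) 𝓘(ℂ, ℂ) (u i) (𝒜.val y)) ((mfderiv 𝓘(ℂ, Fin d → ℂ) 𝓘(ℂ, E) 𝒜.val y) v') = w i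
  rw [hv']
  exact hi

end Univ

/-! ### The charts of the re-charted manifold are the prescribed ones -/

section Charts

variable (e : M → OpenPartialHomeomorph M (Fin d → ℂ)) (hmem : ∀ x, x ∈ (e x).source)
  (he : ∀ x, MDifferentiableOn 𝓘(ℂ, E) 𝓘(ℂ, Fin d → ℂ) (e x) (e x).source)
  (hes : ∀ x, MDifferentiableOn 𝓘(ℂ, Fin d → ℂ) 𝓘(ℂ, E) (e x).symm (e x).target)

/-- **The extended chart of the re-charted manifold at `y` is `e_{val y} ∘ val`.** [folklore] -/
@[simp]
theorem extChartAt_ofUniv_apply (y z : (ofUniv e hmem he hes).Carrier) :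
    extChartAt 𝓘(ℝ, Fin d → ℂ) y z = e ((ofUniv e hmem he hes).val y) ((ofUniv e hmem he hes).val z) :=
  rfl

/-- The complex extended chart of the re-charted manifold at `y` is `e_{val y} ∘ val` too. [folklore] -/
@[simp]
theorem extChartAt_ofUniv_apply' (y z : (ofUniv e hmem he hes).Carrier) :
    extChartAt 𝓘(ℂ, Fin d → ℂ) y z = e ((ofUniv e hmem he hes).val y) ((ofUniv e hmem he hes).val z) :=
  rfl

/-- **The source of the extended chart at `y` is `val⁻¹((e_{val y}).source)`.** [folklore] -/
theorem extChartAt_ofUniv_source (y : (ofUniv e hmem he hes).Carrier) :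
    (extChartAt 𝓘(ℝ, Fin d → ℂ) y).source =
      (ofUniv e hmem he hes).val ⁻¹' (e ((ofUniv e hmem he hes).val y)).source := by
  rw [extChartAt_source]
  change (AmbientHolChart.ofUniv (e _) (he _) (hes _)).source = _
  rw [AmbientHolChart.ofUniv_source]
  rfl

/-- **The target of the extended chart at `y` is `(e_{val y}).target`.** [folklore] -/
theorem extChartAt_ofUniv_target (y : (ofUniv e hmem he hes).Carrier) :
    (extChartAt 𝓘(ℝ, Fin d → ℂ) y).target = (e ((ofUniv e hmem he hes).val y)).target := by
  rw [extChartAt_target]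
  change (𝓘(ℝ, Fin d → ℂ)).symm ⁻¹' (AmbientHolChart.ofUniv (e _) (he _) (hes _)).target ∩ range (𝓘(ℝ, Fin d → ℂ)) = _
  rw [AmbientHolChart.ofUniv_target, modelWithCornersSelf_coe_symm, preimage_id_eq, id,
    ModelWithCorners.range_eq_univ, inter_univ]
  rfl

/-- The inverse extended chart at `y` followed by `val` is `(e_{val y})⁻¹` on the target. [folklore] -/
theorem val_extChartAt_ofUniv_symm (y : (ofUniv e hmem he hes).Carrier) (w : Fin d → ℂ) :
    (ofUniv e hmem he hes).val ((extChartAt 𝓘(ℝ, Fin d → ℂ) y).symm w) =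
      (e ((ofUniv e hmem he hes).val y)).symm w :=
  rfl

end Charts

end AmbientHolAtlas

end Literature.Geometry.Kaehler

end
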